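import HarnessLib
import Summits.ValiantsHypothesis.ValiantsHypothesis.Theorems.Depth4WidthDoor
import Literature.RingTheory.MvPolynomial.LinearFormIdealsHeight
import Mathlib.Algebra.MvPolynomial.PDeriv

/-!
# Depth4DoorStrictnessBeta — strictness of the second door arrow (O29, lens-4 g36)

The SECOND door arrow `β = Depth4WidthDoor.widthDoor_of_boundedDoor` (`BoundedDoor ⟹ WidthDoor`) is
ONE-WAY as a conversion between the two currencies: for the FERMAT family `fermat K n =
Σ_{i<(n+2)^⌊√n⌋} x_i^n` the `WidthDoor`-SHAPE HOLDS (`not_comp_fermat`, from the KRULL WIDTH FLOOR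
`le_mul_of_comp_sum_X_pow`: a composition `F(Q₁,…,Q_q)` with `deg Qᵢ ≤ t < n` puts every `∂_j fermat
= n·x_j^{n-1}` into the LETTER-COMPONENT IDEAL — `≤ q·t` homogeneous generators of positive degree —
whose only minimal prime is then the irrelevant ideal of height `N`, so `N ≤ q·t`), while the
`BoundedDoor`-SHAPE FAILS (`hasSPSPExpr_fermat`: `x_i^n` is ONE product of `2⌊√n⌋+2` powers of
degree `≤ ⌊√n⌋`; take `c = 2`). [cite: Matsumura1987, Thm. 13.5; Tavenas2015, Thm. 1]

HONESTY. NO new invariant: the floor is the D-INSENSITIVE generator-count ≥ Krull-height bound, IN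
the cone ("strength" / Jacobian codimension); it bites only because the witness is a forced NON-p
family on `(n+2)^⌊√n⌋ ≫ q·t` variables (NOT a p-family). For per NOTHING is decided — both cells,
the converse for per and the IDEA-NEEDED leaf (a D-SENSITIVE generator count separating per from
det) are UNCHANGED; METHOD CEILING for per confirmed (Jacobian/strength-type floors `≤ 2n <` door);
the arrow is ONE-WAY only as a conversion between currencies; `γ` is S-currency and untouched.
NOT a rung · 0 S-currency · closes no item · VP ≠ VNP is NOT proved.
-/

set_option linter.dupNamespace false

namespace Summit.ValiantsHypothesis.ValiantsHypothesis.Theorems.Depth4DoorStrictnessBeta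

open MvPolynomial Literature.Computability.AlgebraicComplexity Literature.RingTheory.MvPolynomial

/-- The FERMAT family on the door's variable budget: `fermat K n = Σ_{i < (n+2)^⌊√n⌋} x_i ^ n`
(`N = (n+2)^⌊√n⌋` variables, degree `n`; NOT a p-family). [folklore] -/
noncomputable def fermat (K : Type*) [CommSemiring K] (n : ℕ) :
    MvPolynomial (Fin ((n + 2) ^ Nat.sqrt n)) K :=
  ∑ i, X i ^ n

/-- The LETTER-COMPONENT IDEAL of an alphabet `Q₁, …, Q_q` at bottom degree `t`: spanned by the
homogeneous components of degrees `1, …, t` of the letters (`≤ q·t` generators). [folklore] -/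
noncomputable def letterIdeal {K : Type*} [CommRing K] {N q : ℕ}
    (Q : Fin q → MvPolynomial (Fin N) K) (t : ℕ) : Ideal (MvPolynomial (Fin N) K) :=
  Ideal.span (Set.range fun p : Fin q × Fin t => homogeneousComponent ((p.2 : ℕ) + 1) (Q p.1))

/-! ## §1 The `BoundedDoor`-shape FAILS for the Fermat family -/

/-- Balanced splitting of an exponent: `n ≤ D·t` gives `n = e₁ + ⋯ + e_D` with `e_j ≤ t`. [folklore] -/
theorem exists_split (n D t : ℕ) (h : n ≤ D * t) :
    ∃ e : Fin D → ℕ, (∀ j, e j ≤ t) ∧ ∑ j, e j = n := by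
  induction D generalizing n with
  | zero =>
    refine ⟨Fin.elim0, fun j => j.elim0, ?_⟩
    rw [Finset.sum_of_isEmpty]; omega
  | succ D ih =>
    rw [Nat.add_mul, one_mul] at h
    obtain ⟨e, he, hs⟩ := ih (n - min n t) (by omega)
    have hb : ∀ j, (Fin.cons (min n t) e : Fin (D + 1) → ℕ) j ≤ t := fun j => by
      rcases Fin.eq_zero_or_eq_succ j with rfl | ⟨j, rfl⟩
      · rw [Fin.cons_zero]; exact min_le_right n t
      · rw [Fin.cons_succ]; exact he j
    refine ⟨Fin.cons (min n t) e, hb, ?_⟩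
    rw [Fin.sum_univ_succ, Fin.cons_zero]; simp only [Fin.cons_succ]; rw [hs]; omega

/-- `fermat K n` IS a `ΣΠ^{[2⌊√n⌋+2]}ΣΠ^{[⌊√n⌋]}` expression of top fan-in `(n+2)^(2⌊√n⌋+2)`, for
EVERY `n` (`x_i^n` = one product of `2⌊√n⌋+2` powers `x_i^{e_j}`, `e_j ≤ ⌊√n⌋`; pad by
`Depth4BoundedDoor.hasSPSPExpr_mono`). [folklore] -/
theorem hasSPSPExpr_fermat (K : Type*) [CommSemiring K] [Nontrivial K] (n : ℕ) :
    HasSPSPExpr (fermat K n) ((n + 2) ^ (2 * Nat.sqrt n + 2)) (2 * Nat.sqrt n + 2) (Nat.sqrt n) := by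
  have h1 : n < (Nat.sqrt n + 1) * (Nat.sqrt n + 1) := Nat.lt_succ_sqrt n
  obtain ⟨e, he, hs⟩ := exists_split n (2 * Nat.sqrt n + 2) (Nat.sqrt n)
    (by nlinarith [h1, Nat.zero_le (Nat.sqrt n)])
  refine Depth4BoundedDoor.hasSPSPExpr_mono (s := (n + 2) ^ Nat.sqrt n)
    ⟨fun i j => X i ^ e j, fun i j => ?_, ?_⟩ (Nat.pow_le_pow_right (by omega) (by omega))
    le_rfl (by omega) le_rfl
  · show (X i ^ e j).totalDegree ≤ Nat.sqrt n
    rw [totalDegree_X_pow]; exact he j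
  · show ∑ i, X i ^ n = ∑ i, ∏ j, X i ^ e j
    exact Finset.sum_congr rfl fun i _ => by rw [Finset.prod_pow_eq_pow_sum, hs]

/-! ## §2 Homogeneous bookkeeping -/

section Graded

variable {K : Type*} [Field K] {σ : Type*}

/-- An ideal spanned by homogeneous polynomials contains the homogeneous components of its
members. [folklore] -/
theorem homogeneousComponent_mem_span {S : Set (MvPolynomial σ K)}
    (hS : ∀ g ∈ S, ∃ d, g.IsHomogeneous d) {f : MvPolynomial σ K} (hf : f ∈ Ideal.span S)
    (k : ℕ) : homogeneousComponent k f ∈ Ideal.span S := by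
  induction hf using Submodule.span_induction generalizing k with
  | mem g hg =>
    obtain ⟨d, hd⟩ := hS g hg
    rw [homogeneousComponent_of_mem hd]
    split_ifs
    exacts [Ideal.subset_span hg, Ideal.zero_mem _]
  | zero => rw [map_zero]; exact Ideal.zero_mem _
  | add x y _ _ hx hy => rw [map_add]; exact Ideal.add_mem _ (hx k) (hy k)
  | smul r x _ hx =>
    rw [smul_eq_mul, DepthReduction.homogeneousComponent_mul]
    exact Ideal.sum_mem _ fun i _ => Ideal.mul_mem_left _ _ (hx (k - i))

/-- … and then so does its square. [folklore] -/
theorem homogeneousComponent_mem_sq {I : Ideal (MvPolynomial σ K)}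
    (hI : ∀ g ∈ I, ∀ k, homogeneousComponent k g ∈ I) {f : MvPolynomial σ K} (hf : f ∈ I ^ 2)
    (k : ℕ) : homogeneousComponent k f ∈ I ^ 2 := by
  rw [sq] at hf ⊢; revert k
  refine Submodule.mul_induction_on hf (fun a ha b hb k => ?_) (fun x y hx hy k => ?_)
  · rw [DepthReduction.homogeneousComponent_mul]
    exact Ideal.sum_mem _ fun i _ => Ideal.mul_mem_mul (hI a ha i) (hI b hb (k - i))
  · rw [map_add]; exact Ideal.add_mem _ (hx k) (hy k)

/-- FIRST-ORDER TAYLOR REDUCTION: if every letter is a constant modulo `I`, then every composition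
`F(Q)` is, modulo `I²`, a polynomial `L ∈ K + I` of degree `≤ t`. [folklore] -/
theorem exists_taylor {q t : ℕ} {I : Ideal (MvPolynomial σ K)} {Q : Fin q → MvPolynomial σ K}
    (hdeg : ∀ i, (Q i).totalDegree ≤ t) (hQ : ∀ i, Q i - C (coeff 0 (Q i)) ∈ I)
    (G : MvPolynomial (Fin q) K) :
    ∃ (L : MvPolynomial σ K) (a : K), L.totalDegree ≤ t ∧ L - C a ∈ I ∧ aeval Q G - L ∈ I ^ 2 := by
  induction G using MvPolynomial.induction_on with
  | C a =>
    refine ⟨C a, a, (totalDegree_C a).trans_le (Nat.zero_le _), ?_, ?_⟩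
    · rw [sub_self]; exact Ideal.zero_mem _
    · rw [aeval_C, algebraMap_eq, sub_self]; exact Ideal.zero_mem _
  | add G H ihG ihH =>
    obtain ⟨L, a, hL, hLa, hGL⟩ := ihG
    obtain ⟨M, b, hM, hMb, hHM⟩ := ihH
    refine ⟨L + M, a + b, (totalDegree_add L M).trans (max_le hL hM), ?_, ?_⟩
    · have e : L + M - C (a + b) = (L - C a) + (M - C b) := by rw [C_add]; ring
      rw [e]
      exact Ideal.add_mem _ hLa hMb
    · have e : aeval Q (G + H) - (L + M) = (aeval Q G - L) + (aeval Q H - M) := by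
        rw [map_add]; ring
      rw [e]
      exact Ideal.add_mem _ hGL hHM
  | mul_X G i ih =>
    obtain ⟨L, a, hL, hLa, hGL⟩ := ih
    refine ⟨C (coeff 0 (Q i)) * L + C a * (Q i - C (coeff 0 (Q i))), coeff 0 (Q i) * a,
      (totalDegree_add _ _).trans (max_le ?_ ?_), ?_, ?_⟩
    · exact (totalDegree_mul _ _).trans (by rw [totalDegree_C, zero_add]; exact hL)
    · exact (totalDegree_mul _ _).trans
        (by rw [totalDegree_C, zero_add]; exact (totalDegree_sub_C_le _ _).trans (hdeg i))
    · have e : C (coeff 0 (Q i)) * L + C a * (Q i - C (coeff 0 (Q i))) - C (coeff 0 (Q i) * a) =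
          C (coeff 0 (Q i)) * (L - C a) + C a * (Q i - C (coeff 0 (Q i))) := by
        rw [C_mul]; ring
      rw [e]
      exact Ideal.add_mem _ (Ideal.mul_mem_left _ _ hLa) (Ideal.mul_mem_left _ _ (hQ i))
    · have e : aeval Q (G * X i) - (C (coeff 0 (Q i)) * L + C a * (Q i - C (coeff 0 (Q i)))) =
          (aeval Q G - L) * Q i + (L - C a) * (Q i - C (coeff 0 (Q i))) := by
        rw [map_mul, aeval_X]; ring
      rw [e, sq]
      exact Ideal.add_mem _ (Ideal.mul_mem_right _ _ (by rw [← sq]; exact hGL))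
        (Ideal.mul_mem_mul hLa (hQ i))

/-- A HOMOGENEOUS composition of degree `d > t` lies in `I²` (`I` homogeneous, letters constant
mod `I`, `deg` letters `≤ t`): its degree-`d` component sees nothing of `L`. [folklore] -/
theorem mem_sq_of_comp {q t d : ℕ} {I : Ideal (MvPolynomial σ K)}
    (hI : ∀ g ∈ I, ∀ k, homogeneousComponent k g ∈ I) {Q : Fin q → MvPolynomial σ K}
    (hdeg : ∀ i, (Q i).totalDegree ≤ t) (hQ : ∀ i, Q i - C (coeff 0 (Q i)) ∈ I)
    {F : MvPolynomial (Fin q) K} {f : MvPolynomial σ K} (hf : f.IsHomogeneous d) (htd : t < d)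
    (hF : aeval Q F = f) : f ∈ I ^ 2 := by
  obtain ⟨L, a, hL, -, hFL⟩ := exists_taylor hdeg hQ F
  have h := homogeneousComponent_mem_sq hI hFL d
  rwa [map_sub, hF, homogeneousComponent_eq_self hf,
    homogeneousComponent_eq_zero _ _ (lt_of_le_of_lt hL htd), sub_zero] at h

/-- Leibniz: partial derivatives map `I²` into `I`. [folklore] -/
theorem pderiv_mem_of_mem_sq {I : Ideal (MvPolynomial σ K)} {f : MvPolynomial σ K}
    (hf : f ∈ I ^ 2) (j : σ) : pderiv j f ∈ I := by
  rw [sq] at hf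
  refine Submodule.mul_induction_on hf (fun a ha b hb => ?_) (fun x y hx hy => ?_)
  · rw [pderiv_mul]
    exact Ideal.add_mem _ (Ideal.mul_mem_left _ _ hb) (Ideal.mul_mem_right _ _ ha)
  · rw [map_add]; exact Ideal.add_mem _ hx hy

/-- Every polynomial is its constant term modulo the irrelevant ideal `(x_i : i)`. [folklore] -/
private theorem sub_C_coeff_zero_mem_span_X (g : MvPolynomial σ K) :
    g - C (coeff 0 g) ∈ Ideal.span (Set.range (X : σ → MvPolynomial σ K)) := by
  classical
  induction g using MvPolynomial.induction_on with
  | C a => rw [coeff_zero_C, sub_self]; exact Ideal.zero_mem _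
  | add p q hp hq => rw [coeff_add, C_add, add_sub_add_comm]; exact Ideal.add_mem _ hp hq
  | mul_X p i _ =>
    rw [coeff_mul_X', if_neg, C_0, sub_zero]
    · exact Ideal.mul_mem_left _ _ (Ideal.subset_span ⟨i, rfl⟩)
    · simp

/-- A polynomial without constant term lies in the irrelevant ideal `(x_i : i)`. [folklore] -/
theorem mem_span_X_of_coeff_zero {g : MvPolynomial σ K} (hg : coeff 0 g = 0) :
    g ∈ Ideal.span (Set.range (X : σ → MvPolynomial σ K)) := by
  have h := sub_C_coeff_zero_mem_span_X g
  rwa [hg, C_0, sub_zero] at h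

end Graded

/-! ## §3 The KRULL WIDTH FLOOR and the `WidthDoor`-shape for the Fermat family -/

section Floor

variable {K : Type*} [Field K]

/-- Every letter is its constant term modulo the letter-component ideal. [folklore] -/
theorem sub_C_mem_letterIdeal {N q t : ℕ} {Q : Fin q → MvPolynomial (Fin N) K}
    (hdeg : ∀ i, (Q i).totalDegree ≤ t) (i : Fin q) :
    Q i - C (coeff 0 (Q i)) ∈ letterIdeal Q t := by
  have h1 : ∑ k ∈ Finset.range (t + 1), homogeneousComponent k (Q i) = Q i := by
    conv_rhs => rw [← sum_homogeneousComponent (Q i)]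
    refine (Finset.sum_subset (Finset.range_mono (Nat.succ_le_succ (hdeg i))) ?_).symm
    intro k hk hk'
    refine homogeneousComponent_eq_zero _ _ ?_
    simp only [Finset.mem_range, not_lt] at hk hk'
    omega
  rw [Finset.sum_range_succ', homogeneousComponent_zero] at h1
  rw [← eq_sub_of_add_eq h1]
  unfold letterIdeal
  exact Ideal.sum_mem _ fun k hk => Ideal.subset_span ⟨(i, ⟨k, Finset.mem_range.1 hk⟩), rfl⟩

/-- **KRULL WIDTH FLOOR for sums of powers.** If `Σ_{i<N} x_i^n = F(Q₁, …, Q_q)` with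
`deg Qᵢ ≤ t < n` (`F` ARBITRARY, `char K = 0`), then `N ≤ q·t`: all `x_j^{n-1}` lie in the
letter-component ideal (`≤ q·t` generators inside the irrelevant ideal `𝔪`), so `𝔪` is its unique
minimal prime and `N = ht 𝔪 ≤ q·t` (Krull's height theorem,
`Ideal.height_le_card_of_mem_minimalPrimes_span_finset`; `ht 𝔪 = N` by
`LinearFormIdealsHeight.height_span_eq_finrank`).  D-INSENSITIVE (no hypothesis on `deg F`).
[cite: Matsumura1987, Thm. 13.5] -/
theorem le_mul_of_comp_sum_X_pow [CharZero K] {N q t n : ℕ} (htn : t < n)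
    {Q : Fin q → MvPolynomial (Fin N) K} (hdeg : ∀ i, (Q i).totalDegree ≤ t)
    {F : MvPolynomial (Fin q) K} (hF : aeval Q F = ∑ i, X i ^ n) : N ≤ q * t := by
  classical
  -- the letter-component ideal is homogeneous and contains `Σ x_i^n` squared-deep
  have hI : ∀ g ∈ letterIdeal Q t, ∀ k, homogeneousComponent k g ∈ letterIdeal Q t :=
    fun g hg k => homogeneousComponent_mem_span
      (by rintro _ ⟨p, rfl⟩; exact ⟨_, homogeneousComponent_isHomogeneous _ _⟩) hg k
  have hsq : (∑ i : Fin N, (X i : MvPolynomial (Fin N) K) ^ n) ∈ letterIdeal Q t ^ 2 :=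
    mem_sq_of_comp hI hdeg (sub_C_mem_letterIdeal hdeg) (IsHomogeneous.sum Finset.univ
      (fun i : Fin N => (X i : MvPolynomial (Fin N) K) ^ n) n fun i _ => isHomogeneous_X_pow i n)
      htn hF
  -- hence (Leibniz, `char K = 0`) every `x_j^{n-1}` lies in it
  have hu : IsUnit (n : MvPolynomial (Fin N) K) := by
    rw [← map_natCast (C : K →+* MvPolynomial (Fin N) K) n]
    exact (isUnit_iff_ne_zero.2 (Nat.cast_ne_zero.2 (by omega))).map C
  have hX : ∀ j : Fin N, (X j : MvPolynomial (Fin N) K) ^ (n - 1) ∈ letterIdeal Q t := by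
    intro j
    have h := pderiv_mem_of_mem_sq hsq j
    rw [map_sum, Finset.sum_eq_single j, pderiv_pow, pderiv_X_self, mul_one] at h
    · exact (Ideal.unit_mul_mem_iff_mem _ hu).1 h
    · intro b _ hb
      rw [pderiv_pow, pderiv_X_of_ne hb, mul_zero]
    · intro h; exact absurd (Finset.mem_univ j) h
  -- the irrelevant ideal `𝔪 = (x_j : j)` is prime, contains the letter ideal, is minimal over it
  have hX1 : ∀ ℓ ∈ Set.range (X : Fin N → MvPolynomial (Fin N) K), ℓ.IsHomogeneous 1 := by
    rintro _ ⟨j, rfl⟩; exact isHomogeneous_X K j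
  have hmprime : (Ideal.span (Set.range (X : Fin N → MvPolynomial (Fin N) K))).IsPrime :=
    LinearFormIdeals.isPrime_span_of_isHomogeneous_one hX1
  have hIm : letterIdeal Q t ≤ Ideal.span (Set.range (X : Fin N → MvPolynomial (Fin N) K)) := by
    refine Ideal.span_le.2 ?_
    rintro _ ⟨p, rfl⟩
    refine mem_span_X_of_coeff_zero ?_
    show coeff 0 (homogeneousComponent ((p.2 : ℕ) + 1) (Q p.1)) = 0
    rw [coeff_homogeneousComponent, if_neg]
    rw [map_zero]
    omega
  have hmin : Ideal.span (Set.range (X : Fin N → MvPolynomial (Fin N) K)) ∈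
      (letterIdeal Q t).minimalPrimes :=
    ⟨⟨hmprime, hIm⟩, @fun P hP _ => Ideal.span_le.2 (Set.range_subset_iff.2 fun j =>
      hP.1.mem_of_pow_mem (n - 1) (hP.2 (hX j)))⟩
  -- Krull's height theorem: `N = ht 𝔪 ≤ #generators ≤ q·t`
  have hkr : (Ideal.span (Set.range (X : Fin N → MvPolynomial (Fin N) K))).height ≤
      ((Finset.univ.image fun p : Fin q × Fin t =>
        homogeneousComponent ((p.2 : ℕ) + 1) (Q p.1)).card : ℕ∞) :=
    Ideal.height_le_card_of_mem_minimalPrimes_span_finset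
      (by rwa [Finset.coe_image, Finset.coe_univ, Set.image_univ])
  have hht : (Ideal.span (Set.range (X : Fin N → MvPolynomial (Fin N) K))).height = N := by
    rw [LinearFormIdealsHeight.height_span_eq_finrank hX1,
      finrank_span_eq_card (linearIndependent_X (Fin N) K), Fintype.card_fin]
  have hcard : (Finset.univ.image fun p : Fin q × Fin t =>
      homogeneousComponent ((p.2 : ℕ) + 1) (Q p.1)).card ≤ q * t :=
    Finset.card_image_le.trans
      (by rw [Finset.card_univ, Fintype.card_prod, Fintype.card_fin, Fintype.card_fin])
  have key : (N : ℕ∞) ≤ ((q * t : ℕ) : ℕ∞) := by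
    rw [← hht]
    exact hkr.trans (by exact_mod_cast hcard)
  exact_mod_cast key

/-- **The `WidthDoor`-SHAPE HOLDS for the Fermat family**: for every `c`, at `n = (c+2)²`,
`fermat K n` does NOT factor through width `(n+2)^c` at degrees `(c⌊√n⌋+c, ⌊√n⌋)` — indeed through
no width `< (n+2)^⌊√n⌋/⌊√n⌋` at bottom degree `⌊√n⌋`, whatever the top degree. [cite: Matsumura1987, Thm. 13.5] -/
theorem not_comp_fermat (K : Type*) [Field K] [CharZero K] (c : ℕ) :
    ∃ n : ℕ, ¬ ∃ (Q : Fin ((n + 2) ^ c) → MvPolynomial (Fin ((n + 2) ^ Nat.sqrt n)) K)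
        (F : MvPolynomial (Fin ((n + 2) ^ c)) K),
        (∀ i, (Q i).totalDegree ≤ Nat.sqrt n) ∧ F.totalDegree ≤ c * Nat.sqrt n + c ∧
          aeval Q F = fermat K n := by
  refine ⟨(c + 2) * (c + 2), ?_⟩
  rintro ⟨Q, F, hQ, -, hF⟩
  have hs : Nat.sqrt ((c + 2) * (c + 2)) = c + 2 := Nat.sqrt_eq (c + 2)
  have htn : Nat.sqrt ((c + 2) * (c + 2)) < (c + 2) * (c + 2) := by
    rw [hs]
    nlinarith [Nat.zero_le c]
  have h := le_mul_of_comp_sum_X_pow htn hQ hF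
  rw [hs] at h
  have hm : c + 2 < ((c + 2) * (c + 2) + 2) ^ 2 :=
    lt_of_lt_of_le (by nlinarith [Nat.zero_le c]) (Nat.le_self_pow (by omega) _)
  have h2 : ((c + 2) * (c + 2) + 2) ^ c * (c + 2) < ((c + 2) * (c + 2) + 2) ^ (c + 2) := by
    rw [pow_add]
    exact mul_lt_mul_of_pos_left hm (pow_pos (by omega) c)
  exact absurd h (not_le.2 h2)

/-- **STRICTNESS OF THE SECOND DOOR ARROW (O29)**: for the explicit homogeneous degree-`n` family
`fermat` the `WidthDoor`-shape HOLDS and the `BoundedDoor`-shape FAILS (at `c = 2`, every `n`); so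
`WidthDoor-shape ⟹ BoundedDoor-shape` is FALSE as a conversion between the two currencies (the
arrow `Depth4WidthDoor.widthDoor_of_boundedDoor` is one-way in general: width counts each letter
ONCE, a door-sized expression may carry `n^{Θ(√n)}` DISTINCT letters).  Labels: NOT a rung ·
0 S-currency · closes no item · NOT a p-family (forced) · invariant D-INSENSITIVE (Krull height /
generator count; METHOD CEILING for per untouched) · for per NOTHING is decided — both cells and
the converse stay UNDECIDED · VP ≠ VNP is NOT proved. [cite: Matsumura1987, Thm. 13.5; Tavenas2015, Thm. 1] -/
theorem door_arrow_beta_strict (K : Type*) [Field K] [CharZero K] :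
    (∀ c : ℕ, ∃ n : ℕ, ¬ ∃ (Q : Fin ((n + 2) ^ c) → MvPolynomial (Fin ((n + 2) ^ Nat.sqrt n)) K)
        (F : MvPolynomial (Fin ((n + 2) ^ c)) K),
        (∀ i, (Q i).totalDegree ≤ Nat.sqrt n) ∧ F.totalDegree ≤ c * Nat.sqrt n + c ∧
          aeval Q F = fermat K n) ∧
    ¬ (∀ c : ℕ, ∃ n : ℕ, ¬ HasSPSPExpr (fermat K n) ((n + 2) ^ (c * Nat.sqrt n + c))
      (c * Nat.sqrt n + c) (Nat.sqrt n)) :=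
  ⟨not_comp_fermat K, fun h => by
    obtain ⟨n, hn⟩ := h 2
    exact hn (hasSPSPExpr_fermat K n)⟩

end Floor

end Summit.ValiantsHypothesis.ValiantsHypothesis.Theorems.Depth4DoorStrictnessBeta
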